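import Summits.PneNP.PneNP.Theorems.NegLimitedAmplifiedWindowRungStep
import Summits.PneNP.PneNP.Theorems.NegLimitedDoorCorrelationTransfer
import Summits.PneNP.PneNP.Theorems.NegLimitedDoorFKGMixtures
import Literature.Computability.Complexity.GnpSprinkling
import Mathlib
import HarnessLib

/-!
# Amplified critical window — the sprinkling ladder and the critical-window bookkeeping
(cell pnp-ideate, rung F-N1/p3, ROUND-11; line `amplified-window` on item stmt-PneNP-19860, stub B
`CriticalWindowHardness`; card HOME/pnp-ideate-p3/r11/amplified-window.md §5 (b),(c),(e))

Elementary facts used by the assembly of stub B (the balanced critical-window ladder mixture):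

* `gnpProb_mono_density` — for a MONOTONE `f` and `0 ≤ p ≤ p' ≤ 1`: `Pr_p[f = 1] ≤ Pr_{p'}[f = 1]`
  (coupling `G(n,p') = G(n,p) ∪ G(n,q)`, union law `sum_sum_gnpWeight_ite_sup`);
* `gnpProb_clique_le_lambda` (Markov: `Pr_p[ω_k ≥ 1] ≤ λ = C(n,k)p^{C(k,2)}`) and
  `lambda_sq_le_secondMoment_mul_gnpProb` (Paley–Zygmund / Cauchy–Schwarz: `λ² ≤ E_p[N_k²]·Pr_p[ω_k ≥ 1]`);
* the ladder `ladder p₀ q i = 1 − (1−p₀)(1−q)^i`: `ladder_succ` (`p_{i+1} = p_i ⊕ q`), range `[0,1]`,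
  `p₀ ≤ p_i ≤ p₀ + i q`;
* the ladder mixture `ladderMix n T P x = Σ_{i<T} (1/T)·gnpWeight n (P i) x`: nonnegative, FKG-lattice
  (`NegLimitedDoor.fkg_gnpMixture`), and its `massAt`/`agreeAt` as rung averages
  (`massAt_ladderMix_true`, `massAt_ladderMix_false`, `agreeAt_ladderMix`).

HONEST FRAMING: bookkeeping for the OPEN stub B; no hardness is proved here; FRONTIER rung F-N1 —
nothing here bears on P vs NP.
-/

set_option linter.dupNamespace false -- `Summit.PneNP.PneNP.…`: summit = sub-problem name (D-0017 single-conjunct layout)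

namespace Summit.PneNP.PneNP.Theorems.NegLimitedDoor.AmplifiedWindowBase

open Finset
open Literature.Computability.Complexity
open Summit.PneNP.PneNP.Theorems.NegLimitedDoor (massAt agreeAt)

/-! ### Monotone events: probability is nondecreasing in the density -/

/-- For a monotone Boolean `f` and `0 ≤ p ≤ p' ≤ 1`: `Pr_{G(n,p)}[f = 1] ≤ Pr_{G(n,p')}[f = 1]`
(couple `G(n,p') = G(n,p) ∪ G(n,q)` with `q = (p' − p)/(1 − p)`). -/
theorem gnpProb_mono_density {n : ℕ} {p p' : ℝ} (hp0 : 0 ≤ p) (hpp' : p ≤ p') (hp'1 : p' ≤ 1)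
    {f : ((⊤ : SimpleGraph (Fin n)).edgeSet → Bool) → Bool} (hf : Monotone f) :
    gnpProb n p (univ.filter fun x => f x = true) ≤ gnpProb n p' (univ.filter fun x => f x = true) := by
  classical
  rcases eq_or_lt_of_le (hpp'.trans hp'1) with hp1 | hp1
  · have hp' : p' = 1 := le_antisymm hp'1 (hp1 ▸ hpp')
    subst hp1; subst hp'
    exact le_rfl
  · set q : ℝ := (p' - p) / (1 - p) with hq
    have h1p : 0 < 1 - p := sub_pos.2 hp1
    have hq0 : 0 ≤ q := div_nonneg (sub_nonneg.2 hpp') h1p.le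
    have hq1 : q ≤ 1 := (div_le_one h1p).2 (by linarith)
    have hpq : p + q - p * q = p' := by
      rw [hq]; field_simp; ring
    rw [← hpq, ← sum_sum_gnpWeight_ite_sup p q (fun z => f z = true), gnpProb_filter]
    -- compare termwise in `x` after summing out `y`
    have hy1 : ∑ y, gnpWeight n q y = 1 := sum_gnpWeight q
    refine sum_le_sum fun x _ => ?_
    by_cases hfx : f x = true
    · rw [if_pos hfx]
      have hall : ∀ y, f (x ⊔ y) = true := by
        intro y
        have h1 : true ≤ f (x ⊔ y) := hfx ▸ hf (le_sup_left : x ≤ x ⊔ y)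
        revert h1
        cases f (x ⊔ y) <;> decide
      calc gnpWeight n p x = gnpWeight n p x * ∑ y, gnpWeight n q y := by rw [hy1, mul_one]
        _ = ∑ y, gnpWeight n p x * gnpWeight n q y * (if f (x ⊔ y) = true then (1 : ℝ) else 0) := by
            rw [mul_sum]
            refine sum_congr rfl fun y _ => ?_
            rw [if_pos (hall y), mul_one]
        _ ≤ _ := le_rfl
    · rw [if_neg hfx]
      exact sum_nonneg fun y _ => mul_nonneg (mul_nonneg (gnpWeight_nonneg hp0 hp1.le x)
        (gnpWeight_nonneg hq0 hq1 y)) (by split_ifs <;> norm_num)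

/-! ### Markov and Paley–Zygmund for the clique count -/

/-- The clique event as `cliqueFn` or as `ω_k ≥ 1`. -/
theorem filter_one_le_cliqueCount_eq (n k : ℕ) :
    (univ.filter fun x : (⊤ : SimpleGraph (Fin n)).edgeSet → Bool => 1 ≤ cliqueCount n k x) =
      univ.filter fun x => cliqueFn n k x = true := by
  ext x
  simp only [mem_filter, mem_univ, true_and]
  rw [← cliqueCount_ne_zero_iff, Nat.one_le_iff_ne_zero]

/-- **Markov**: `Pr_p[ω_k ≥ 1] ≤ E_p[N_k] = C(n,k)·p^{C(k,2)}` for `p ∈ [0,1]`. -/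
theorem gnpProb_clique_le_lambda {n k : ℕ} {p : ℝ} (hp0 : 0 ≤ p) (hp1 : p ≤ 1) :
    gnpProb n p (univ.filter fun x => cliqueFn n k x = true) ≤ (n.choose k : ℝ) * p ^ k.choose 2 := by
  classical
  rw [← sum_gnpWeight_mul_cliqueCount n k p, gnpProb_filter]
  refine sum_le_sum fun x _ => ?_
  split_ifs with h
  · have h1 : (1 : ℝ) ≤ cliqueCount n k x := by
      have := (cliqueCount_ne_zero_iff x).2 h
      exact_mod_cast Nat.one_le_iff_ne_zero.2 this
    nlinarith [gnpWeight_nonneg hp0 hp1 x]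
  · exact mul_nonneg (gnpWeight_nonneg hp0 hp1 x) (Nat.cast_nonneg _)

/-- **Paley–Zygmund** (Cauchy–Schwarz): `λ² ≤ E_p[N_k²] · Pr_p[ω_k ≥ 1]` for `p ∈ [0,1]`. -/
theorem lambda_sq_le_secondMoment_mul_gnpProb {n k : ℕ} {p : ℝ} (hp0 : 0 ≤ p) (hp1 : p ≤ 1) :
    ((n.choose k : ℝ) * p ^ k.choose 2) ^ 2 ≤
      (∑ x, gnpWeight n p x * (cliqueCount n k x : ℝ) ^ 2) *
        gnpProb n p (univ.filter fun x => cliqueFn n k x = true) := by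
  classical
  rw [← sum_gnpWeight_mul_cliqueCount n k p, gnpProb_filter]
  have hr : ∀ x : (⊤ : SimpleGraph (Fin n)).edgeSet → Bool,
      gnpWeight n p x * (cliqueCount n k x : ℝ) =
        gnpWeight n p x * (cliqueCount n k x : ℝ) * (if cliqueFn n k x = true then (1 : ℝ) else 0) := by
    intro x
    by_cases h0 : cliqueCount n k x = 0
    · simp [h0]
    · rw [if_pos ((cliqueCount_ne_zero_iff x).1 h0), mul_one]
  rw [sum_congr rfl fun x _ => hr x]
  refine sum_sq_le_sum_mul_sum_of_sq_le_mul univ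
    (fun x _ => mul_nonneg (gnpWeight_nonneg hp0 hp1 x) (sq_nonneg _))
    (fun x _ => by split_ifs <;> [exact gnpWeight_nonneg hp0 hp1 x; exact le_rfl]) fun x _ => le_of_eq ?_
  split_ifs <;> ring

/-! ### The sprinkling ladder -/

/-- The sprinkling ladder started at `p₀` with step density `q`: `p_i = 1 − (1 − p₀)(1 − q)^i`. -/
noncomputable def ladder (p₀ q : ℝ) (i : ℕ) : ℝ := 1 - (1 - p₀) * (1 - q) ^ i

/-- `p_0 = p₀`. -/
theorem ladder_zero (p₀ q : ℝ) : ladder p₀ q 0 = p₀ := by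
  simp [ladder]

/-- The ladder step is a sprinkle: `p_{i+1} = p_i ⊕ q = p_i + q − p_i q`. -/
theorem ladder_succ (p₀ q : ℝ) (i : ℕ) :
    ladder p₀ q (i + 1) = ladder p₀ q i + q - ladder p₀ q i * q := by
  simp only [ladder, pow_succ]
  ring

/-- `p₀ ≤ p_i` (for `p₀ ≤ 1`, `0 ≤ q ≤ 1`). -/
theorem le_ladder {p₀ q : ℝ} (hp1 : p₀ ≤ 1) (hq0 : 0 ≤ q) (hq1 : q ≤ 1) (i : ℕ) :
    p₀ ≤ ladder p₀ q i := by
  unfold ladder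
  have h1 : (1 - q) ^ i ≤ 1 := pow_le_one₀ (by linarith) (by linarith)
  nlinarith [mul_le_mul_of_nonneg_left h1 (sub_nonneg.2 hp1)]

/-- `p_i ≤ 1` (for `p₀ ≤ 1`, `q ≤ 1`). -/
theorem ladder_le_one {p₀ q : ℝ} (hp1 : p₀ ≤ 1) (hq1 : q ≤ 1) (i : ℕ) : ladder p₀ q i ≤ 1 := by
  unfold ladder
  have : 0 ≤ (1 - p₀) * (1 - q) ^ i := mul_nonneg (sub_nonneg.2 hp1) (pow_nonneg (by linarith) _)
  linarith

/-- `0 ≤ p_i` (for `0 ≤ p₀ ≤ 1`, `0 ≤ q ≤ 1`). -/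
theorem ladder_nonneg {p₀ q : ℝ} (hp0 : 0 ≤ p₀) (hp1 : p₀ ≤ 1) (hq0 : 0 ≤ q) (hq1 : q ≤ 1) (i : ℕ) :
    0 ≤ ladder p₀ q i :=
  hp0.trans (le_ladder hp1 hq0 hq1 i)

/-- Bernoulli: `p_i ≤ p₀ + i·q` (for `0 ≤ p₀ ≤ 1`, `0 ≤ q ≤ 1`). -/
theorem ladder_le_add_mul {p₀ q : ℝ} (hp0 : 0 ≤ p₀) (hp1 : p₀ ≤ 1) (hq0 : 0 ≤ q) (hq1 : q ≤ 1) (i : ℕ) :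
    ladder p₀ q i ≤ p₀ + i * q := by
  unfold ladder
  have hB : 1 - (i : ℝ) * q ≤ (1 - q) ^ i := by
    have h := one_add_mul_le_pow (show (-2 : ℝ) ≤ -q by linarith) i
    rw [show (1 : ℝ) + -q = 1 - q by ring, show (1 : ℝ) + (i : ℝ) * -q = 1 - i * q by ring] at h
    exact h
  have h1 := mul_le_mul_of_nonneg_left hB (sub_nonneg.2 hp1)
  have h2 : 0 ≤ p₀ * ((i : ℝ) * q) := mul_nonneg hp0 (mul_nonneg (Nat.cast_nonneg i) hq0)
  nlinarith [h1, h2]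

/-- The ladder is nondecreasing in `i` (for `p₀ ≤ 1`, `0 ≤ q ≤ 1`). -/
theorem ladder_mono {p₀ q : ℝ} (hp1 : p₀ ≤ 1) (hq0 : 0 ≤ q) (hq1 : q ≤ 1) {i j : ℕ} (hij : i ≤ j) :
    ladder p₀ q i ≤ ladder p₀ q j := by
  unfold ladder
  have h : (1 - q) ^ j ≤ (1 - q) ^ i := pow_le_pow_of_le_one (by linarith) (by linarith) hij
  nlinarith [mul_le_mul_of_nonneg_left h (sub_nonneg.2 hp1)]

/-! ### The ladder mixture -/

/-- The uniform mixture of `T` Erdős–Rényi weights at densities `P 0, …, P (T−1)`. -/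
noncomputable def ladderMix (n T : ℕ) (P : ℕ → ℝ) (x : (⊤ : SimpleGraph (Fin n)).edgeSet → Bool) : ℝ :=
  ∑ i ∈ range T, (1 / (T : ℝ)) * gnpWeight n (P i) x

/-- The mixture is nonnegative when all densities lie in `[0,1]`. -/
theorem ladderMix_nonneg {n T : ℕ} {P : ℕ → ℝ} (hP : ∀ i ∈ range T, 0 ≤ P i ∧ P i ≤ 1)
    (x : (⊤ : SimpleGraph (Fin n)).edgeSet → Bool) : 0 ≤ ladderMix n T P x :=
  sum_nonneg fun i hi => mul_nonneg (by positivity) (gnpWeight_nonneg (hP i hi).1 (hP i hi).2 x)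

/-- The mixture satisfies the FKG lattice condition (`NegLimitedDoor.fkg_gnpMixture`). -/
theorem ladderMix_fkg {n T : ℕ} {P : ℕ → ℝ} (hP : ∀ i ∈ range T, 0 ≤ P i ∧ P i ≤ 1)
    (x y : (⊤ : SimpleGraph (Fin n)).edgeSet → Bool) :
    ladderMix n T P x * ladderMix n T P y ≤ ladderMix n T P (x ⊓ y) * ladderMix n T P (x ⊔ y) :=
  Summit.PneNP.PneNP.Theorems.NegLimitedDoor.fkg_gnpMixture n (range T) (fun _ => 1 / (T : ℝ)) P
    (fun _ _ => by positivity) hP x y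

/-- `massAt` of the mixture on a predicate value is the average of the rung probabilities. -/
theorem massAt_ladderMix {n T : ℕ} (P : ℕ → ℝ) (f : ((⊤ : SimpleGraph (Fin n)).edgeSet → Bool) → Bool)
    (b : Bool) :
    massAt (ladderMix n T P) f b =
      (1 / (T : ℝ)) * ∑ i ∈ range T, gnpProb n (P i) (univ.filter fun x => f x = b) := by
  classical
  unfold Summit.PneNP.PneNP.Theorems.NegLimitedDoor.massAt
  have h : ∀ x : (⊤ : SimpleGraph (Fin n)).edgeSet → Bool, (if f x = b then ladderMix n T P x else 0) =
      ∑ i ∈ range T, (1 / (T : ℝ)) * (if f x = b then gnpWeight n (P i) x else 0) := by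
    intro x
    split_ifs
    · simp only [ladderMix]
    · simp
  rw [sum_congr rfl fun x _ => h x, sum_comm, mul_sum]
  refine sum_congr rfl fun i _ => ?_
  rw [gnpProb_filter, mul_sum]

/-- `agreeAt` of the mixture: the average of `1 − Pr_{p_i}[g ≠ f]` (each rung has total mass `1`
for every real density). -/
theorem agreeAt_ladderMix {n T : ℕ} (P : ℕ → ℝ)
    (f g : ((⊤ : SimpleGraph (Fin n)).edgeSet → Bool) → Bool) :
    agreeAt (ladderMix n T P) f g =
      (1 / (T : ℝ)) * ∑ i ∈ range T, (1 - gnpProb n (P i) (univ.filter fun x => g x ≠ f x)) := by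
  classical
  have hcompl : ∀ i, 1 - gnpProb n (P i) (univ.filter fun x => g x ≠ f x) =
      gnpProb n (P i) (univ.filter fun x => g x = f x) := by
    intro i
    rw [← gnpProb_compl]
    congr 1
    ext x
    simp
  simp_rw [hcompl]
  unfold Summit.PneNP.PneNP.Theorems.NegLimitedDoor.agreeAt
  have h : ∀ x : (⊤ : SimpleGraph (Fin n)).edgeSet → Bool, (if g x = f x then ladderMix n T P x else 0) =
      ∑ i ∈ range T, (1 / (T : ℝ)) * (if g x = f x then gnpWeight n (P i) x else 0) := by
    intro x
    split_ifs
    · simp only [ladderMix]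
    · simp
  rw [sum_congr rfl fun x _ => h x, sum_comm, mul_sum]
  refine sum_congr rfl fun i _ => ?_
  rw [gnpProb_filter, mul_sum]

end Summit.PneNP.PneNP.Theorems.NegLimitedDoor.AmplifiedWindowBase
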